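import Mathlib
import Literature.NumberTheory.Sieve.LargeSieveCharacters
import Literature.NumberTheory.QuadraticFields.JacobiCharacterPrimitiveProofs
import Literature.NumberTheory.Sieve.IwaniecAlmostPrimesProp1Corollary
import HarnessLib

/-!
# Route `IsogenyRedei`, crux `SplitBlockJacobi` (stmt-Parity-11583), line `split-mass-middle-prime`:
# the pure digit pieces in the Pólya–Vinogradov range (partial result towards `stub_pureDigitPieces`)

The registered stub `stub_pureDigitPieces` of the line skeleton
(`Summits/Parity/BatemanHorn/Cruxes/SplitBlockJacobi/Lines/split-mass-middle-prime.lean`) asks, for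
`1/2 < θ < θ′ < 1`, `0 < η`, `θ′ + η < 1`, that the `ℓ¹`-sum over `(Q, ν, k, a)` — primes
`x^θ < Q ≤ x^{θ′}`, roots `ν² ≡ −1 (mod Q)`, moduli `1 ≤ k ≤ x^η`, root classes `a mod k` — of the
absolute values of the digit-character sums
`Σ_{u : ν + Q(a+ku) ≤ x} ((ν²+1)/Q + 2ν(a+ku) | Q)` is `o(x)`.

This file proves the statement with the hypothesis `θ′ + η < 1` replaced by the
**Pólya–Vinogradov range condition** `θ′/2 < 1 − θ′ − η` (i.e. `3θ′/2 + η < 1`):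
`pureDigitPieces_of_polyaVinogradov_range`.  It is a `--supports` helper; it does NOT close the stub
(whose remaining range `1 − θ′ − η ≤ θ′/2` needs Burgess's bound, Iwaniec–Kowalski Thm 12.6, not in
the tree, for `θ′/4 < 1 − θ′ − η`, and is open beyond that).

## Proof

* Each inner sum runs over an initial segment `u < H` (the condition `ν + Q(a + ku) ≤ x` is monotone
  in `u`), and its summand is the Legendre symbol of the linear form `α + βu`, `α = (ν²+1)/Q + 2νa`,
  `β = 2νk`, with `Q ∤ β` (`Q > x^θ ≥ 2` is odd, `Q ∤ ν` as `Q ∣ ν² + 1`, and `k ≤ x^η ≤ x^θ < Q`).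
  Writing `α + βu = β(β⁻¹α + u)` in `ZMod Q`, the sum is `χ_Q(β)` times a sum of the primitive
  quadratic character `χ_Q = (· | Q)` (tree: `QuadraticFields.jacobiChar`,
  `isPrimitive_jacobiChar`) over `H` consecutive residues, hence of modulus `≤ √Q (1 + log Q)` by
  the tree's Pólya–Vinogradov inequality `Sieve.LargeSieve.polyaVinogradov`
  (`abs_sum_range_jacobiSym_linear_le`).
* Bookkeeping: the root classes `a mod k` number `≤ ρ(k)` (`a ↦ ν + Qa mod k` is injective into the
  roots of `t² ≡ −1 (mod k)` as `(Q, k) = 1`; tree `Iwaniec1978.rho`), `Σ_{k ≤ x^η} ρ(k) ≤ C x^η`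
  (tree `Iwaniec1978.exists_sum_rho_le`), `ρ(Q) ≤ 2` roots `ν` (tree `Iwaniec1978.rho_le_two`), and
  `≤ x^{θ′} + 1 ≤ 2x^{θ′}` primes `Q`.  Total: `≤ 4C · x^{θ′ + η + θ′/2} (1 + log x) = o(x)` exactly
  when `3θ′/2 + η < 1`.

No new definitions; everything is proved (no named facts).
-/

noncomputable section

open Filter Finset Asymptotics
open scoped Classical

open Literature.NumberTheory.QuadraticFields (jacobiChar jacobiChar_natCast isPrimitive_jacobiChar)
open Literature.NumberTheory.Sieve.Iwaniec1978 (rho rho_le_two exists_sum_rho_le)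

namespace Summit.Parity.BatemanHorn.Cruxes.SplitBlockJacobi.SplitMassMiddlePrime

/-! ### Elementary tools -/

/-- A finite set of naturals closed downwards is the initial segment `range (#S)`. [folklore] -/
theorem eq_range_card_of_lowerClosed {S : Finset ℕ} (hS : ∀ u ∈ S, ∀ v ≤ u, v ∈ S) :
    S = Finset.range S.card := by
  obtain ⟨m, rfl⟩ : ∃ m, S = Finset.range m := by
    rcases S.eq_empty_or_nonempty with h | hne
    · exact ⟨0, by simp [h]⟩
    · refine ⟨S.max' hne + 1, Finset.Subset.antisymm (fun u hu => ?_) (fun v hv => ?_)⟩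
      · exact Finset.mem_range.2 (Nat.lt_succ_of_le (S.le_max' u hu))
      · exact hS _ (S.max'_mem hne) v (Nat.le_of_lt_succ (Finset.mem_range.1 hv))
  rw [Finset.card_range]

/-- For `Q` prime, `2 < Q`, `Q ∣ ν² + 1` and `1 ≤ k < Q`: `Q ∤ 2νk`. [folklore] -/
theorem not_dvd_two_mul_mul {Q ν k : ℕ} (hQ : Q.Prime) (h2 : 2 < Q) (hν : Q ∣ ν ^ 2 + 1)
    (hk1 : 1 ≤ k) (hkQ : k < Q) : ¬ Q ∣ 2 * ν * k := by
  intro h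
  rcases (Nat.Prime.dvd_mul hQ).1 h with h' | h'
  · rcases (Nat.Prime.dvd_mul hQ).1 h' with h'' | h''
    · exact absurd (Nat.le_of_dvd two_pos h'') (by omega)
    · have h1 : Q ∣ 1 := (Nat.dvd_add_right (dvd_pow h'' two_ne_zero)).1 hν
      exact hQ.one_lt.ne' (Nat.dvd_one.1 h1)
  · exact absurd (Nat.le_of_dvd (by omega) h') (by omega)

/-- **Root classes.** For `(Q, k) = 1` the classes `a mod k` with `Qk ∣ (ν + Qa)² + 1` number at most
`ρ(k) = #{t mod k : t² + 1 ≡ 0}`: the map `a ↦ (ν + Qa) mod k` is injective on `a < k` and lands in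
the roots. [folklore] -/
theorem card_filter_range_dvd_sq_add_one_le_rho {Q k : ℕ} (hQk : Q.Coprime k) (ν : ℕ) :
    ((Finset.range k).filter (fun a : ℕ => Q * k ∣ (ν + Q * a) ^ 2 + 1)).card ≤ rho k := by
  rcases Nat.eq_zero_or_pos k with rfl | hk
  · simp
  unfold rho
  refine Finset.card_le_card_of_injOn (fun a => (ν + Q * a) % k) (fun a ha => ?_)
    (fun a ha a' ha' h => ?_)
  · rw [Finset.mem_coe, Finset.mem_filter] at ha
    rw [Finset.mem_coe, Finset.mem_filter, Finset.mem_range]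
    refine ⟨Nat.mod_lt _ hk, ?_⟩
    have h1 : k ∣ (ν + Q * a) ^ 2 + 1 := (Dvd.intro_left Q rfl).trans ha.2
    exact (Nat.modEq_zero_iff_dvd).1
      ((((Nat.mod_modEq (ν + Q * a) k).pow 2).add_right 1).trans
        ((Nat.modEq_zero_iff_dvd).2 h1))
  · rw [Finset.mem_coe, Finset.mem_filter, Finset.mem_range] at ha ha'
    have hmod : ν + Q * a ≡ ν + Q * a' [MOD k] := h
    have h2 : Q * a ≡ Q * a' [MOD k] := Nat.ModEq.add_left_cancel' ν hmod
    have h3 : a ≡ a' [MOD k] :=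
      Nat.ModEq.cancel_left_of_coprime (by simpa [Nat.coprime_comm] using hQk) h2
    exact Nat.ModEq.eq_of_lt_of_lt h3 ha.1 ha'.1

/-! ### Pólya–Vinogradov for the Legendre symbol of a linear form -/

/-- **Pólya–Vinogradov along a linear form.** For `Q` an odd prime and `Q ∤ β`, any `α` and any
length `H`: `|Σ_{u < H} (α + βu | Q)| ≤ √Q (1 + log Q)`.  Indeed `(α + βu | Q) = (β | Q)(β⁻¹α + u | Q)`
and `u ↦ β⁻¹α + u` runs over `H` consecutive residues, to which the Pólya–Vinogradov inequality for
the primitive character `(· | Q)` (tree `LargeSieve.polyaVinogradov`, Cojocaru–Murty (8.14)) applies.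
[folklore] -/
theorem abs_sum_range_jacobiSym_linear_le {Q : ℕ} (hQ : Q.Prime) (hQ2 : Q ≠ 2) {β : ℕ}
    (hβ : ¬ Q ∣ β) (α H : ℕ) :
    |∑ u ∈ Finset.range H, (jacobiSym ((α + β * u : ℕ) : ℤ) Q : ℝ)| ≤
      Real.sqrt Q * (1 + Real.log Q) := by
  haveI : NeZero Q := ⟨hQ.ne_zero⟩
  haveI : Fact Q.Prime := ⟨hQ⟩
  have hprim : (jacobiChar Q).IsPrimitive :=
    isPrimitive_jacobiChar (hQ.odd_of_ne_two hQ2) hQ.prime.squarefree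
  have hβ0 : (β : ZMod Q) ≠ 0 := by
    rw [Ne, ZMod.natCast_eq_zero_iff]; exact hβ
  -- (1) complexify and factor out `χ(β)`
  have h1 : ((∑ u ∈ Finset.range H, (jacobiSym ((α + β * u : ℕ) : ℤ) Q : ℝ) : ℝ) : ℂ) =
      jacobiChar Q β * ∑ u ∈ Finset.range H, jacobiChar Q ((β : ZMod Q)⁻¹ * α + u) := by
    rw [Complex.ofReal_sum, Finset.mul_sum]
    refine Finset.sum_congr rfl fun u _ => ?_
    rw [Complex.ofReal_intCast, ← jacobiChar_natCast, ← map_mul]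
    congr 1
    push_cast
    rw [mul_add, ← mul_assoc, mul_inv_cancel₀ hβ0, one_mul]
  -- (2) the shifted sum is a character sum over an interval of naturals
  have h2 : ∑ u ∈ Finset.range H, jacobiChar Q ((β : ZMod Q)⁻¹ * α + u) =
      ∑ n ∈ Finset.Ioc ((β : ZMod Q)⁻¹ * α - 1).val (((β : ZMod Q)⁻¹ * α - 1).val + H),
        jacobiChar Q n := by
    rw [← Finset.Ico_add_one_add_one_eq_Ioc, Finset.sum_Ico_eq_sum_range,
      show ((β : ZMod Q)⁻¹ * α - 1).val + H + 1 - (((β : ZMod Q)⁻¹ * α - 1).val + 1) = H by omega]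
    refine Finset.sum_congr rfl fun u _ => ?_
    congr 1
    rw [Nat.cast_add, Nat.cast_add, Nat.cast_one, ZMod.natCast_zmod_val, sub_add_cancel]
  -- (3) Pólya–Vinogradov
  have h3 := Literature.NumberTheory.Sieve.LargeSieve.polyaVinogradov hQ.two_le hprim
    ((β : ZMod Q)⁻¹ * α - 1).val H
  rw [← h2] at h3
  rw [← Real.norm_eq_abs, ← Complex.norm_real, h1, norm_mul]
  calc ‖jacobiChar Q β‖ * ‖∑ u ∈ Finset.range H, jacobiChar Q ((β : ZMod Q)⁻¹ * α + u)‖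
      ≤ 1 * (Real.sqrt Q * (1 + Real.log Q)) :=
        mul_le_mul (DirichletCharacter.norm_le_one _ _) h3 (norm_nonneg _) zero_le_one
    _ = Real.sqrt Q * (1 + Real.log Q) := one_mul _

/-- **The inner sums of the stub.** For `Q` an odd prime with `Q ∤ 2νk`, the digit-character sum over
`{u ≤ x : ν + Q(a + ku) ≤ x}` (an initial segment of `ℕ`) of `(c + 2ν(a + ku) | Q)` — the Legendre
symbol of the linear form `(c + 2νa) + (2νk)u` — has modulus `≤ √Q (1 + log Q)`. [folklore] -/
theorem abs_inner_le {Q ν k a x c : ℕ} (hQ : Q.Prime) (hQ2 : Q ≠ 2) (hβ : ¬ Q ∣ 2 * ν * k) :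
    |∑ u ∈ (Finset.range (x + 1)).filter (fun u : ℕ => ν + Q * (a + k * u) ≤ x),
        (jacobiSym ((c + 2 * ν * (a + k * u) : ℕ) : ℤ) Q : ℝ)| ≤
      Real.sqrt Q * (1 + Real.log Q) := by
  have hlow : ∀ u ∈ (Finset.range (x + 1)).filter (fun u : ℕ => ν + Q * (a + k * u) ≤ x),
      ∀ v ≤ u, v ∈ (Finset.range (x + 1)).filter (fun u : ℕ => ν + Q * (a + k * u) ≤ x) := by
    intro u hu v hvu
    simp only [Finset.mem_filter, Finset.mem_range] at hu ⊢
    have : Q * (a + k * v) ≤ Q * (a + k * u) :=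
      Nat.mul_le_mul_left _ (Nat.add_le_add_left (Nat.mul_le_mul_left _ hvu) _)
    omega
  rw [eq_range_card_of_lowerClosed hlow]
  have hsum : ∀ u : ℕ, c + 2 * ν * (a + k * u) = (c + 2 * ν * a) + (2 * ν * k) * u :=
    fun u => by ring
  rw [Finset.sum_congr rfl fun u _ => by rw [hsum u]]
  exact abs_sum_range_jacobiSym_linear_le hQ hQ2 hβ _ _

/-! ### Bookkeeping over `(Q, ν, k, a)` -/

/-- **Abstract bookkeeping** for a quadruple sum: inner terms `≤ B`, `a`-counts `≤ ρ(k)`,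
`Σ_k ρ(k) ≤ R`, `ν`-counts `≤ 2`, `Q`-count `≤ N` give the total `≤ N · 2 · R · B`. [folklore] -/
theorem sum_sum_sum_sum_le {SQ Sk : Finset ℕ} {Sν : ℕ → Finset ℕ} {Sa : ℕ → ℕ → ℕ → Finset ℕ}
    {f : ℕ → ℕ → ℕ → ℕ → ℝ} {B R N : ℝ} (hB : 0 ≤ B)
    (hf : ∀ Q ∈ SQ, ∀ ν ∈ Sν Q, ∀ k ∈ Sk, ∀ a ∈ Sa Q ν k, f Q ν k a ≤ B)
    (ha : ∀ Q ∈ SQ, ∀ ν ∈ Sν Q, ∀ k ∈ Sk, ((Sa Q ν k).card : ℝ) ≤ rho k)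
    (hk : ∑ k ∈ Sk, (rho k : ℝ) ≤ R)
    (hν : ∀ Q ∈ SQ, ((Sν Q).card : ℝ) ≤ 2)
    (hQ : (SQ.card : ℝ) ≤ N) (hR : 0 ≤ R) :
    ∑ Q ∈ SQ, ∑ ν ∈ Sν Q, ∑ k ∈ Sk, ∑ a ∈ Sa Q ν k, f Q ν k a ≤ N * (2 * (R * B)) := by
  calc ∑ Q ∈ SQ, ∑ ν ∈ Sν Q, ∑ k ∈ Sk, ∑ a ∈ Sa Q ν k, f Q ν k a
      ≤ ∑ Q ∈ SQ, ∑ ν ∈ Sν Q, ∑ k ∈ Sk, (rho k : ℝ) * B := by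
        refine Finset.sum_le_sum fun Q hQ' => Finset.sum_le_sum fun ν hν' =>
          Finset.sum_le_sum fun k hk' => ?_
        calc ∑ a ∈ Sa Q ν k, f Q ν k a ≤ ∑ a ∈ Sa Q ν k, B :=
              Finset.sum_le_sum fun a ha' => hf Q hQ' ν hν' k hk' a ha'
          _ = ((Sa Q ν k).card : ℝ) * B := by rw [Finset.sum_const, nsmul_eq_mul]
          _ ≤ (rho k : ℝ) * B := mul_le_mul_of_nonneg_right (ha Q hQ' ν hν' k hk') hB
    _ ≤ ∑ Q ∈ SQ, ∑ ν ∈ Sν Q, R * B := by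
        refine Finset.sum_le_sum fun Q hQ' => Finset.sum_le_sum fun ν hν' => ?_
        rw [← Finset.sum_mul]
        exact mul_le_mul_of_nonneg_right hk hB
    _ = ∑ Q ∈ SQ, ((Sν Q).card : ℝ) * (R * B) := by
        refine Finset.sum_congr rfl fun Q _ => ?_
        rw [Finset.sum_const, nsmul_eq_mul]
    _ ≤ ∑ Q ∈ SQ, 2 * (R * B) := by
        refine Finset.sum_le_sum fun Q hQ' => ?_
        exact mul_le_mul_of_nonneg_right (hν Q hQ') (mul_nonneg hR hB)
    _ = (SQ.card : ℝ) * (2 * (R * B)) := by rw [Finset.sum_const, nsmul_eq_mul]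
    _ ≤ N * (2 * (R * B)) := mul_le_mul_of_nonneg_right hQ (by positivity)

/-! ### The theorem: `PureDigitPieces` in the Pólya–Vinogradov range -/

/-- **The pure digit pieces are `o(x)` in the Pólya–Vinogradov range.** For `1/2 < θ < θ′ < 1`,
`0 < η` and `θ′/2 < 1 − θ′ − η` (i.e. `3θ′/2 + η < 1`, which implies the stub's `θ′ + η < 1`):
`Σ_{x^θ<Q≤x^{θ′} prime} Σ_{ν²≡−1 (Q), ν<Q} Σ_{1≤k≤x^η} Σ_{a<k, Qk ∣ (ν+Qa)²+1}
   |Σ_{u ≤ x : ν + Q(a+ku) ≤ x} ((ν²+1)/Q + 2ν(a+ku) | Q)| = o(x)`.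
Each inner sum is `≤ √Q (1 + log Q) ≤ x^{θ′/2}(1 + log x)` by Pólya–Vinogradov
(`abs_inner_le`), and there are `≤ 2x^{θ′} · 2 · C x^η` index triples weighted by root classes
(`sum_sum_sum_sum_le` with `card_filter_range_dvd_sq_add_one_le_rho`, `Iwaniec1978.exists_sum_rho_le`,
`Iwaniec1978.rho_le_two`), so the total is `≤ 4C x^{θ′+η+θ′/2}(1 + log x) = o(x)`.  This is the
literal statement of `stub_pureDigitPieces` with its hypothesis `θ′ + η < 1` strengthened to the
Pólya–Vinogradov range; the Burgess range `θ′/4 < 1 − θ′ − η` would need Burgess's bound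
(Iwaniec–Kowalski Thm 12.6, not in the tree), and beyond it the statement is open. [folklore] -/
theorem pureDigitPieces_of_polyaVinogradov_range :
    ∀ θ θ' η : ℝ, 1 / 2 < θ → θ < θ' → θ' < 1 → 0 < η → θ' / 2 < 1 - θ' - η →
      (fun x : ℕ =>
        ∑ Q ∈ (Finset.range (x + 1)).filter
            (fun Q : ℕ => Q.Prime ∧ (x : ℝ) ^ θ < (Q : ℝ) ∧ (Q : ℝ) ≤ (x : ℝ) ^ θ'),
          ∑ ν ∈ (Finset.range Q).filter (fun ν : ℕ => Q ∣ ν ^ 2 + 1),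
            ∑ k ∈ (Finset.Icc 1 x).filter (fun k : ℕ => (k : ℝ) ≤ (x : ℝ) ^ η),
              ∑ a ∈ (Finset.range k).filter (fun a : ℕ => Q * k ∣ (ν + Q * a) ^ 2 + 1),
                |∑ u ∈ (Finset.range (x + 1)).filter (fun u : ℕ => ν + Q * (a + k * u) ≤ x),
                    (jacobiSym (((ν ^ 2 + 1) / Q + 2 * ν * (a + k * u) : ℕ) : ℤ) Q : ℝ)|)
        =o[Filter.atTop] fun x : ℕ => (x : ℝ) := by
  intro θ θ' η hθ hθθ' hθ'1 hη hr
  obtain ⟨C, hC0, hC⟩ := exists_sum_rho_le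
  -- the exponent of the majorant `x^s (1 + log x)`, `s = θ' + η + θ'/2 < 1`
  set s : ℝ := θ' + η + θ' / 2 with hs
  have hs1 : s < 1 := by rw [hs]; linarith
  have hθ0 : 0 < θ := by linarith
  have hθ'0 : 0 < θ' := by linarith
  have hηθ : η ≤ θ := by linarith
  have hev_η : ∀ᶠ x : ℕ in atTop, (2 : ℝ) ≤ (x : ℝ) ^ η :=
    ((tendsto_rpow_atTop hη).comp tendsto_natCast_atTop_atTop).eventually_ge_atTop 2
  have hev_θ : ∀ᶠ x : ℕ in atTop, (2 : ℝ) ≤ (x : ℝ) ^ θ :=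
    ((tendsto_rpow_atTop hθ0).comp tendsto_natCast_atTop_atTop).eventually_ge_atTop 2
  -- Step 2 first: `x^s (1 + log x) = o(x)` on `ℝ`, transported to `ℕ`
  have hreal : (fun y : ℝ => y ^ s * (1 + Real.log y)) =o[atTop] fun y : ℝ => y := by
    have h1 : (fun y : ℝ => 1 + Real.log y) =o[atTop] fun y : ℝ => y ^ (1 - s) := by
      refine IsLittleO.add ?_ (isLittleO_log_rpow_atTop (by linarith))
      exact isLittleO_const_left.2
        (Or.inr (tendsto_norm_atTop_atTop.comp (tendsto_rpow_atTop (by linarith))))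
    have h2 := (isBigO_refl (fun y : ℝ => y ^ s) atTop).mul_isLittleO h1
    refine h2.trans_isBigO (IsBigO.of_bound 1 ?_)
    filter_upwards [eventually_gt_atTop 0] with y hy
    refine le_of_eq ?_
    rw [← Real.rpow_add hy, show s + (1 - s) = 1 by ring, Real.rpow_one, one_mul]
  have hnat : (fun x : ℕ => 4 * C * ((x : ℝ) ^ s * (1 + Real.log x))) =o[atTop]
      fun x : ℕ => (x : ℝ) :=
    (hreal.comp_tendsto tendsto_natCast_atTop_atTop).const_mul_left (4 * C)
  refine IsBigO.trans_isLittleO (IsBigO.of_bound 1 ?_) hnat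
  -- Step 1: the majorant `4 C x^s (1 + log x)`, eventually
  filter_upwards [eventually_ge_atTop 1, hev_η, hev_θ] with x hx1 hxη hxθ
  rw [one_mul, Real.norm_eq_abs, Real.norm_eq_abs]
  have hx0 : (0 : ℝ) < x := by exact_mod_cast hx1
  have hx1' : (1 : ℝ) ≤ x := by exact_mod_cast hx1
  have hxηθ : (x : ℝ) ^ η ≤ (x : ℝ) ^ θ := Real.rpow_le_rpow_of_exponent_le hx1' hηθ
  set B : ℝ := (x : ℝ) ^ (θ' / 2) * (1 + Real.log x) with hB
  have hB0 : 0 ≤ B := by positivity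
  refine (abs_of_nonneg ?_).trans_le
    ((sum_sum_sum_sum_le (R := C * (x : ℝ) ^ η) (N := 2 * (x : ℝ) ^ θ') hB0
      ?_ ?_ ?_ ?_ ?_ (by positivity)).trans ?_)
  · positivity
  · -- the inner sums: Pólya–Vinogradov
    intro Q hQ ν hν k hk a _
    simp only [Finset.mem_filter, Finset.mem_range, Finset.mem_Icc] at hQ hν hk
    obtain ⟨hQx, hQp, hQθ, hQθ'⟩ := hQ
    have h2Q : 2 < Q := by exact_mod_cast hxθ.trans_lt hQθ
    have hkQ : k < Q := by exact_mod_cast (hk.2.trans hxηθ).trans_lt hQθ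
    have hβ : ¬ Q ∣ 2 * ν * k := not_dvd_two_mul_mul hQp h2Q hν.2 hk.1.1 hkQ
    refine (abs_inner_le hQp (by omega) hβ).trans ?_
    have hQpos : (0 : ℝ) < Q := by exact_mod_cast hQp.pos
    have hQx' : (Q : ℝ) ≤ x := by exact_mod_cast Nat.lt_succ_iff.1 hQx
    have hsqrt : Real.sqrt Q ≤ (x : ℝ) ^ (θ' / 2) := by
      calc Real.sqrt Q ≤ Real.sqrt ((x : ℝ) ^ θ') := Real.sqrt_le_sqrt hQθ'
        _ = (x : ℝ) ^ (θ' / 2) := by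
            rw [Real.sqrt_eq_rpow, ← Real.rpow_mul hx0.le]; congr 1; ring
    exact mul_le_mul hsqrt (by linarith [Real.log_le_log hQpos hQx'])
      (by positivity) (by positivity)
  · -- the root classes `a mod k`
    intro Q hQ ν _ k hk
    simp only [Finset.mem_filter, Finset.mem_range, Finset.mem_Icc] at hQ hk
    obtain ⟨_, hQp, hQθ, _⟩ := hQ
    have hkQ : k < Q := by exact_mod_cast (hk.2.trans hxηθ).trans_lt hQθ
    have hcop : Q.Coprime k :=
      (Nat.Prime.coprime_iff_not_dvd hQp).2 fun h => absurd (Nat.le_of_dvd (by omega) h) (by omega)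
    exact_mod_cast card_filter_range_dvd_sq_add_one_le_rho hcop ν
  · -- `Σ_{k ≤ x^η} ρ(k) ≤ C x^η`
    calc ∑ k ∈ (Finset.Icc 1 x).filter (fun k : ℕ => (k : ℝ) ≤ (x : ℝ) ^ η), (rho k : ℝ)
        ≤ ∑ k ∈ Finset.Icc 1 ⌊(x : ℝ) ^ η⌋₊, (rho k : ℝ) := by
          refine Finset.sum_le_sum_of_subset_of_nonneg (fun k hk => ?_) fun _ _ _ =>
            Nat.cast_nonneg _
          simp only [Finset.mem_filter, Finset.mem_Icc] at hk ⊢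
          exact ⟨hk.1.1, Nat.le_floor hk.2⟩
      _ ≤ C * (x : ℝ) ^ η := hC _ hxη
  · -- two roots `ν` per prime `Q`
    intro Q hQ
    simp only [Finset.mem_filter, Finset.mem_range] at hQ
    exact_mod_cast rho_le_two hQ.2.1
  · -- the number of primes `Q ≤ x^{θ'}`
    have hsub : (Finset.range (x + 1)).filter
        (fun Q : ℕ => Q.Prime ∧ (x : ℝ) ^ θ < (Q : ℝ) ∧ (Q : ℝ) ≤ (x : ℝ) ^ θ') ⊆
        Finset.range (⌊(x : ℝ) ^ θ'⌋₊ + 1) := by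
      intro Q hQ
      simp only [Finset.mem_filter, Finset.mem_range] at hQ ⊢
      exact Nat.lt_succ_of_le (Nat.le_floor hQ.2.2.2)
    calc (((Finset.range (x + 1)).filter
          (fun Q : ℕ => Q.Prime ∧ (x : ℝ) ^ θ < (Q : ℝ) ∧ (Q : ℝ) ≤ (x : ℝ) ^ θ')).card : ℝ)
        ≤ ((Finset.range (⌊(x : ℝ) ^ θ'⌋₊ + 1)).card : ℝ) := by
          exact_mod_cast Finset.card_le_card hsub
      _ = (⌊(x : ℝ) ^ θ'⌋₊ : ℝ) + 1 := by rw [Finset.card_range]; push_cast; ring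
      _ ≤ (x : ℝ) ^ θ' + 1 := by gcongr; exact Nat.floor_le (by positivity)
      _ ≤ 2 * (x : ℝ) ^ θ' := by have := Real.one_le_rpow hx1' hθ'0.le; linarith
  · -- `2x^{θ'} · 2 · C x^η · x^{θ'/2}(1 + log x) = 4C x^s (1 + log x)`
    calc 2 * (x : ℝ) ^ θ' * (2 * (C * (x : ℝ) ^ η * B))
        = 4 * C * ((x : ℝ) ^ s * (1 + Real.log x)) := by
          rw [hB, hs, Real.rpow_add hx0, Real.rpow_add hx0]; ring
      _ ≤ |4 * C * ((x : ℝ) ^ s * (1 + Real.log x))| := le_abs_self _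

end Summit.Parity.BatemanHorn.Cruxes.SplitBlockJacobi.SplitMassMiddlePrime

end
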